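import Literature.Geometry.Manifold.CircleSubmersionConnectedFibres
import Mathlib.Analysis.Normed.Module.Connected
import HarnessLib

/-!
# A local diffeomorphism of the circle close to a homeomorphism is a diffeomorphism

Topic `Literature/Topology/FourManifolds`; the `k = 1` (circle links, codimension two) case of
the link-map step in the smoothing of PD homeomorphisms (Munkres, Ann. of Math. 72 (1960), §4;
Campbell–D'Onofrio–Vítek, J. Geom. Anal. (2026), Lemma 3.2, "the projection to the circle is
injective").  For `k ≥ 2` the normalised link map of a simplex is a diffeomorphism of `𝕊ᵏ` as
soon as it is a local diffeomorphism (`TubeLink.lean`, simple connectivity); for `k = 1` a local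
diffeomorphism of the circle is only a covering, and the missing input is its degree.  In the
sweep the link map at radius `r/4` is `C⁰`-close to the ray map of the conewise differential of
the homeomorphism at the simplex, which is a HOMEOMORPHISM of the circle (Munkres (1966),
Thm. 8.4, `PDDifferential.lean`); this file proves the abstract statement that closes the case:

* `exists_diffeomorph_circle_of_close` — a `C^∞` self-map `ĥ` of `𝕊¹` with injective
  differential everywhere which is pointwise at chordal distance `< 1` from a homeomorphism `Â`
  of `𝕊¹` is (the map of) a diffeomorphism of `𝕊¹`.

The proof runs on the universal cover `circlePoint : ℝ → 𝕊¹` with the lifting API of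
`CircleDiffeotopyProofs.lean` and never mentions a degree theory beyond the integer `d` of
`exists_int_apply_add_two_pi`: two lifts of one map differ by a constant
(`exists_int_forall_eq_add_of_lifts`); the lift `B ∘ A` of `Â⁻¹ ∘ Â = id` forces
`deg Â · deg Â⁻¹ = 1`, so `deg Â = ±1` (`degree_eq_one_or_of_homeomorph`); chordal distance `< 1`
between `circlePoint x` and `circlePoint y` forces `|x - y - 2πm| < π/2`
(`exists_abs_sub_lt_of_norm_circlePoint_sub_lt`), whence pointwise-close maps have equal degrees
(`degree_eq_of_close`); the lift `H` of `ĥ` has nowhere-vanishing derivative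
(`deriv_lift_ne_zero_of_injective_mfderiv`, through the tree's
`Literature.Geometry.Manifold.mfderiv_circlePoint_injective`), hence is
strictly monotone, and a strictly monotone lift of degree `±1` descends to an injective map
(`injective_of_strictMono_lift`); surjectivity is open-compact-connected; a bijective local
diffeomorphism is a diffeomorphism (Mathlib's `IsLocalDiffeomorph.diffeomorphOfBijective`).
Everything is proved; no definitions; no named facts.

## References

* J. R. Munkres, *Obstructions to the smoothing of piecewise-differentiable homeomorphisms*, Ann.
  of Math. (2) 72 (1960), 521–554, §4. [Munkres1960]
* D. Campbell, L. D'Onofrio, T. Vítek, *Diffeomorphic approximation of piecewise affine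
  homeomorphisms*, J. Geom. Anal. 36 (2026), Lemma 3.2. [CampbellDonofrioVitek2026]
* M. W. Hirsch, *Differential Topology* (1976), Ch. 8 §3 (lifts and degrees of circle maps).
-/

open scoped Manifold ContDiff Topology Real
open Function Set Filter Metric Module

noncomputable section

namespace Literature.Topology.FourManifolds

/-- Local notation: `𝔼 n` is the model Euclidean space `EuclideanSpace ℝ (Fin n)`. -/
local notation "𝔼 " n:arg => EuclideanSpace ℝ (Fin n)

/-- Local notation: `𝕊 n` is the unit sphere in `EuclideanSpace ℝ (Fin (n + 1))`. -/
local notation "𝕊 " n:arg => (Metric.sphere (0 : EuclideanSpace ℝ (Fin (n + 1))) 1)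

attribute [local instance] fact_finrank_euclideanSpace_two

/-! ### Two lifts of one map differ by a constant -/

/-- **Uniqueness of lifts up to the deck group.** Two continuous lifts `Φ`, `L` of the same
self-map of the circle differ by a constant integer multiple of `2π` (the integer-valued
continuous function `(Φ - L)/2π` on the connected line). [folklore] -/
theorem exists_int_forall_eq_add_of_lifts {φ : (𝕊 1) → 𝕊 1} {Φ L : ℝ → ℝ} (hΦ : Continuous Φ)
    (hL : Continuous L) (hΦl : ∀ θ, circlePoint (Φ θ) = φ (circlePoint θ))
    (hLl : ∀ θ, circlePoint (L θ) = φ (circlePoint θ)) :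
    ∃ k : ℤ, ∀ θ, Φ θ = L θ + k * (2 * π) := by
  have h : ∀ θ, circlePoint (Φ θ) = circlePoint (L θ) := fun θ ↦ by rw [hΦl, hLl]
  choose k hk using fun θ ↦ exists_eq_add_of_circlePoint_eq (h θ)
  have hloc : IsLocallyConstant k := by
    refine (IsLocallyConstant.iff_eventually_eq k).2 fun θ₀ ↦ ?_
    obtain ⟨k₀, hk₀⟩ :=
      exists_eventuallyEq_add_of_circlePoint_eq (x₀ := θ₀) hΦ.continuousAt hL.continuousAt h
    have hkk : ∀ᶠ θ in 𝓝 θ₀, k θ = k₀ := by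
      filter_upwards [hk₀] with θ hθ
      have h2π : (0 : ℝ) < 2 * π := by positivity
      have : (k θ : ℝ) * (2 * π) = k₀ * (2 * π) := by linarith [hk θ]
      exact_mod_cast mul_right_cancel₀ h2π.ne' this
    filter_upwards [hkk] with θ hθ
    rw [hθ, hkk.self_of_nhds]
  exact ⟨k 0, fun θ ↦ by rw [hk θ, hloc.apply_eq_of_preconnectedSpace θ 0]⟩

/-! ### Degree arithmetic -/

/-- Iterating the deck relation: `Φ (θ + 2πk) = Φ θ + 2πkd` for a lift of degree `d`.
[folklore] -/
theorem apply_add_int_mul_two_pi_of_degree {Φ : ℝ → ℝ} {d : ℤ}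
    (h : ∀ θ, Φ (θ + 2 * π) = Φ θ + d * (2 * π)) (θ : ℝ) (k : ℤ) :
    Φ (θ + k * (2 * π)) = Φ θ + k * d * (2 * π) := by
  induction k using Int.induction_on generalizing θ with
  | zero => simp
  | succ i ih =>
    have e : θ + ((i : ℤ) + 1 : ℤ) * (2 * π) = θ + (i : ℤ) * (2 * π) + 2 * π := by push_cast; ring
    rw [e, h, ih]
    push_cast
    ring
  | pred i ih =>
    have h' := h (θ + (-(i : ℤ) - 1 : ℤ) * (2 * π))
    have e : θ + (-(i : ℤ) - 1 : ℤ) * (2 * π) + 2 * π = θ + (-(i : ℤ) : ℤ) * (2 * π) := by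
      push_cast; ring
    rw [e, ih] at h'
    push_cast at h' ⊢
    linarith

/-- **The degree of a homeomorphism of the circle is `±1`.** If `A` is a continuous lift of a
homeomorphism `Â` with `A (θ + 2π) = A θ + 2πd`, then `d = 1` or `d = -1`: a lift `B` of `Â⁻¹`
(degree `d'`) gives the lift `B ∘ A` of the identity, which is `id + 2πk`, and evaluating at
`θ + 2π` yields `d d' = 1`. [folklore] -/
theorem degree_eq_one_or_of_homeomorph (Â : (𝕊 1) ≃ₜ 𝕊 1) {A : ℝ → ℝ} (hA : Continuous A)
    (hAl : ∀ θ, circlePoint (A θ) = Â (circlePoint θ)) {d : ℤ}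
    (hd : ∀ θ, A (θ + 2 * π) = A θ + d * (2 * π)) : d = 1 ∨ d = -1 := by
  obtain ⟨B, hB, hBl⟩ := exists_continuous_lift Â.symm.continuous
  obtain ⟨d', hd'⟩ := exists_int_apply_add_two_pi hB hBl
  have hBA : ∀ θ, circlePoint ((B ∘ A) θ) = id (circlePoint θ) := fun θ ↦ by
    rw [comp_apply, hBl, hAl, Homeomorph.symm_apply_apply, id]
  obtain ⟨k, hk⟩ := exists_int_forall_eq_add_of_lifts (φ := id) (hB.comp hA) continuous_id hBA
    fun _ ↦ rfl
  have h0 := hk 0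
  have h1 := hk (0 + 2 * π)
  rw [comp_apply, hd, apply_add_int_mul_two_pi_of_degree hd' (A 0) d] at h1
  rw [comp_apply] at h0
  simp only [id_eq] at h0 h1
  have h2π : (0 : ℝ) < 2 * π := by positivity
  have e : ((d : ℝ) * d') * (2 * π) = 1 * (2 * π) := by linarith
  have hdd : (d : ℝ) * d' = 1 := mul_right_cancel₀ h2π.ne' e
  have hdd' : d * d' = 1 := by exact_mod_cast hdd
  exact Int.eq_one_or_neg_one_of_mul_eq_one hdd'

/-! ### Chordal closeness of points of the circle -/

/-- The squared chordal distance: `‖circlePoint x - circlePoint y‖² = 2 - 2 cos (x - y)`.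
[folklore] -/
theorem norm_circlePoint_sub_sq (x y : ℝ) :
    ‖((circlePoint x : 𝕊 1) : 𝔼 2) - circlePoint y‖ ^ 2 = 2 - 2 * Real.cos (x - y) := by
  rw [EuclideanSpace.norm_eq, Real.sq_sqrt (Finset.sum_nonneg fun _ _ ↦ by positivity),
    Fin.sum_univ_two]
  simp only [PiLp.sub_apply, circlePoint_apply_zero, circlePoint_apply_one, Real.norm_eq_abs,
    sq_abs]
  rw [Real.cos_sub]
  linear_combination Real.sin_sq_add_cos_sq x + Real.sin_sq_add_cos_sq y

/-- **Chordal distance `< 1` forces angular distance `< π/2` modulo `2π`.** [folklore] -/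
theorem exists_abs_sub_lt_of_norm_circlePoint_sub_lt {x y : ℝ}
    (h : ‖((circlePoint x : 𝕊 1) : 𝔼 2) - circlePoint y‖ < 1) :
    ∃ m : ℤ, |x - y - m * (2 * π)| < π / 2 := by
  have hcos : 0 < Real.cos (x - y) := by
    have h0 : 0 ≤ ‖((circlePoint x : 𝕊 1) : 𝔼 2) - circlePoint y‖ := norm_nonneg _
    have h2 : ‖((circlePoint x : 𝕊 1) : 𝔼 2) - circlePoint y‖ ^ 2 < 1 := by nlinarith
    rw [norm_circlePoint_sub_sq] at h2
    linarith
  have hp : (0 : ℝ) < 2 * π := by positivity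
  refine ⟨toIocDiv hp (-π) (x - y), ?_⟩
  have hmem := toIocMod_mem_Ioc hp (-π) (x - y)
  have hdec := toIocMod_add_toIocDiv_zsmul hp (-π) (x - y)
  rw [zsmul_eq_mul] at hdec
  have ht' : x - y - toIocDiv hp (-π) (x - y) * (2 * π) = toIocMod hp (-π) (x - y) := by linarith
  rw [ht']
  set t' := toIocMod hp (-π) (x - y) with ht'def
  have hcos' : 0 < Real.cos t' := by
    have e : Real.cos (x - y) = Real.cos t' := by
      conv_lhs => rw [← hdec]
      exact Real.cos_add_int_mul_two_pi t' _
    rwa [e] at hcos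
  rw [abs_lt]
  refine ⟨?_, ?_⟩
  · by_contra hle
    rw [not_lt] at hle
    have : Real.cos t' ≤ 0 := by
      rw [← Real.cos_neg]
      exact Real.cos_nonpos_of_pi_div_two_le_of_le (by linarith) (by linarith [hmem.1])
    linarith
  · by_contra hle
    rw [not_lt] at hle
    have : Real.cos t' ≤ 0 :=
      Real.cos_nonpos_of_pi_div_two_le_of_le hle (by linarith [hmem.2])
    linarith

/-! ### Pointwise-close maps have equal degrees -/

/-- **Equal degrees.** If two self-maps `φ`, `ψ` of the circle are pointwise at chordal distance
`< 1`, then continuous lifts `Φ`, `Ψ` of them have the same degree: the integer `m` with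
`|Φ - Ψ - 2πm| < π/2` is locally constant, hence constant, and comparing at `θ` and `θ + 2π`
gives `|d - d'| < 1`. [folklore] -/
theorem degree_eq_of_close {φ ψ : (𝕊 1) → 𝕊 1} {Φ Ψ : ℝ → ℝ} (hΦ : Continuous Φ)
    (hΨ : Continuous Ψ) (hΦl : ∀ θ, circlePoint (Φ θ) = φ (circlePoint θ))
    (hΨl : ∀ θ, circlePoint (Ψ θ) = ψ (circlePoint θ)) {d d' : ℤ}
    (hd : ∀ θ, Φ (θ + 2 * π) = Φ θ + d * (2 * π))
    (hd' : ∀ θ, Ψ (θ + 2 * π) = Ψ θ + d' * (2 * π))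
    (hclose : ∀ u : 𝕊 1, ‖((φ u : 𝕊 1) : 𝔼 2) - ψ u‖ < 1) : d = d' := by
  have hm : ∀ θ, ∃ m : ℤ, |Φ θ - Ψ θ - m * (2 * π)| < π / 2 := fun θ ↦
    exists_abs_sub_lt_of_norm_circlePoint_sub_lt (by rw [hΦl, hΨl]; exact hclose _)
  choose m hm using hm
  have hπ : (0 : ℝ) < π := Real.pi_pos
  have hD : Continuous fun θ ↦ Φ θ - Ψ θ := hΦ.sub hΨ
  -- `m` is locally constant, hence constant
  have hloc : IsLocallyConstant m := by
    refine (IsLocallyConstant.iff_eventually_eq m).2 fun θ₀ ↦ ?_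
    have hev : ∀ᶠ θ in 𝓝 θ₀, |(Φ θ - Ψ θ) - (Φ θ₀ - Ψ θ₀)| < π / 2 := by
      have ht := Metric.tendsto_nhds.1 (hD.tendsto θ₀) (π / 2) (by positivity)
      filter_upwards [ht] with θ hθ
      rwa [Real.dist_eq] at hθ
    filter_upwards [hev] with θ hθ
    have h1 := hm θ
    have h0 := hm θ₀
    rw [abs_lt] at h1 h0 hθ
    have key : |((m θ : ℝ) - m θ₀) * (2 * π)| < 2 * π := by
      rw [abs_lt]
      constructor <;> linarith
    have key' : |((m θ - m θ₀ : ℤ) : ℝ)| < 1 := by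
      rw [abs_mul, abs_of_pos (by positivity : (0 : ℝ) < 2 * π)] at key
      push_cast
      exact lt_of_mul_lt_mul_right (by linarith : |((m θ : ℝ) - m θ₀)| * (2 * π) < 1 * (2 * π))
        (by positivity)
    have hint : |m θ - m θ₀| < 1 := by exact_mod_cast key'
    exact eq_of_sub_eq_zero (Int.abs_lt_one_iff.1 hint)
  have hmc : ∀ θ, m θ = m 0 := fun θ ↦ hloc.apply_eq_of_preconnectedSpace θ 0
  have h1 := hm (0 + 2 * π)
  have h0 := hm 0
  rw [hd, hd', hmc] at h1
  rw [abs_lt] at h1 h0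
  have key : |((d : ℝ) - d') * (2 * π)| < 2 * π := by
    rw [abs_lt]
    constructor <;> linarith
  have key' : |((d - d' : ℤ) : ℝ)| < 1 := by
    rw [abs_mul, abs_of_pos (by positivity : (0 : ℝ) < 2 * π)] at key
    push_cast
    exact lt_of_mul_lt_mul_right (by linarith : |((d : ℝ) - d')| * (2 * π) < 1 * (2 * π))
      (by positivity)
  have hint : |d - d'| < 1 := by exact_mod_cast key'
  exact eq_of_sub_eq_zero (Int.abs_lt_one_iff.1 hint)

/-! ### Local diffeomorphisms of the circle and their lifts -/

/-- **Lifts of immersions of the circle have nowhere-vanishing derivative.** If `ĥ : 𝕊¹ → 𝕊¹`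
is `C^∞` with injective differential everywhere and `Φ` is a continuous lift of `ĥ`, then
`Φ' θ ≠ 0` for all `θ`: differentiate `circlePoint ∘ Φ = ĥ ∘ circlePoint`. [folklore] -/
theorem deriv_lift_ne_zero_of_injective_mfderiv {ĥ : (𝕊 1) → 𝕊 1}
    (hsm : ContMDiff (𝓡 1) (𝓡 1) ∞ ĥ) (hinj : ∀ u, Injective (mfderiv (𝓡 1) (𝓡 1) ĥ u))
    {Φ : ℝ → ℝ} (hΦ : Continuous Φ) (hlift : ∀ θ, circlePoint (Φ θ) = ĥ (circlePoint θ))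
    (θ : ℝ) : deriv Φ θ ≠ 0 := by
  have hΦs : ContDiff ℝ ∞ Φ :=
    contDiff_of_circlePoint_comp_eq (hsm.comp contMDiff_circlePoint) hΦ hlift
  intro h0
  -- `mfderiv Φ θ = 0`
  have hΦd : HasMFDerivAt 𝓘(ℝ, ℝ) 𝓘(ℝ, ℝ) Φ θ
      (ContinuousLinearMap.smulRight (1 : ℝ →L[ℝ] ℝ) (deriv Φ θ)) :=
    hasMFDerivAt_iff_hasFDerivAt.2 ((hΦs.differentiable (by simp)) θ).hasDerivAt.hasFDerivAt
  -- the two chain rules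
  have hL : HasMFDerivAt 𝓘(ℝ, ℝ) (𝓡 1) (circlePoint ∘ Φ) θ
      ((mfderiv 𝓘(ℝ, ℝ) (𝓡 1) circlePoint (Φ θ)).comp
        (ContinuousLinearMap.smulRight (1 : ℝ →L[ℝ] ℝ) (deriv Φ θ))) :=
    ((contMDiff_circlePoint (Φ θ)).mdifferentiableAt (by simp)).hasMFDerivAt.comp θ hΦd
  have hR : HasMFDerivAt 𝓘(ℝ, ℝ) (𝓡 1) (ĥ ∘ circlePoint) θ
      ((mfderiv (𝓡 1) (𝓡 1) ĥ (circlePoint θ)).comp (mfderiv 𝓘(ℝ, ℝ) (𝓡 1) circlePoint θ)) :=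
    ((hsm (circlePoint θ)).mdifferentiableAt (by simp)).hasMFDerivAt.comp θ
      ((contMDiff_circlePoint θ).mdifferentiableAt (by simp)).hasMFDerivAt
  have hfun : circlePoint ∘ Φ = ĥ ∘ circlePoint := funext fun t ↦ hlift t
  rw [hfun] at hL
  have heq := hasMFDerivAt_unique hR hL
  let one : TangentSpace 𝓘(ℝ, ℝ) θ := (1 : ℝ)
  have h := DFunLike.congr_fun heq one
  change (mfderiv (𝓡 1) (𝓡 1) ĥ (circlePoint θ)) ((mfderiv 𝓘(ℝ, ℝ) (𝓡 1) circlePoint θ) one) =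
    (mfderiv 𝓘(ℝ, ℝ) (𝓡 1) circlePoint (Φ θ))
      (ContinuousLinearMap.smulRight (1 : ℝ →L[ℝ] ℝ) (deriv Φ θ) one) at h
  rw [ContinuousLinearMap.smulRight_apply, h0, smul_zero] at h
  have h' : (mfderiv (𝓡 1) (𝓡 1) ĥ (circlePoint θ)) ((mfderiv 𝓘(ℝ, ℝ) (𝓡 1) circlePoint θ) one) =
      (mfderiv (𝓡 1) (𝓡 1) ĥ (circlePoint θ)) 0 :=
    (h.trans (map_zero _)).trans (map_zero _).symm
  have h1 : (mfderiv 𝓘(ℝ, ℝ) (𝓡 1) circlePoint θ) one = 0 := hinj _ h'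
  have h2 : one = 0 := Literature.Geometry.Manifold.mfderiv_circlePoint_injective θ (by rw [h1, map_zero])
  have h3 : (1 : ℝ) = 0 := h2
  exact one_ne_zero h3

/-- A `C^∞` self-map of the circle with injective differential everywhere is a local
diffeomorphism (inverse function theorem). [folklore] -/
theorem isLocalDiffeomorph_circle_of_injective_mfderiv {ĥ : (𝕊 1) → 𝕊 1}
    (hsm : ContMDiff (𝓡 1) (𝓡 1) ∞ ĥ) (hinj : ∀ u, Injective (mfderiv (𝓡 1) (𝓡 1) ĥ u)) :
    IsLocalDiffeomorph (𝓡 1) (𝓡 1) ∞ ĥ := by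
  intro u
  set L : EuclideanSpace ℝ (Fin 1) ≃L[ℝ] EuclideanSpace ℝ (Fin 1) :=
    LinearEquiv.toContinuousLinearEquiv
      (LinearEquiv.ofInjectiveEndo (mfderiv (𝓡 1) (𝓡 1) ĥ u).toLinearMap (hinj u)) with hL
  refine isLocalDiffeomorphAt_of_mfderiv isOpen_univ (mem_univ u) hsm.contMDiffOn (by simp) L ?_
  ext v
  rfl

/-- **A strictly monotone lift of degree `±1` descends to an injective map.** [folklore] -/
theorem injective_of_strictMono_lift {ĥ : (𝕊 1) → 𝕊 1} {H : ℝ → ℝ}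
    (hlift : ∀ θ, circlePoint (H θ) = ĥ (circlePoint θ)) (hmono : StrictMono H ∨ StrictAnti H)
    {d : ℤ} (hd : ∀ θ, H (θ + 2 * π) = H θ + d * (2 * π)) (hd1 : d = 1 ∨ d = -1) :
    Injective ĥ := by
  have hinjH : Injective H := hmono.elim StrictMono.injective StrictAnti.injective
  have hdd : d * d = 1 := by rcases hd1 with rfl | rfl <;> norm_num
  intro u v huv
  obtain ⟨a, rfl⟩ := circlePoint_surjective u
  obtain ⟨b, rfl⟩ := circlePoint_surjective v
  rw [← hlift, ← hlift] at huv
  obtain ⟨j, hj⟩ := exists_eq_add_of_circlePoint_eq huv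
  -- `H a = H b + 2πj = H (b + 2π j d)`
  have e : H a = H (b + (j * d : ℤ) * (2 * π)) := by
    rw [apply_add_int_mul_two_pi_of_degree hd, hj]
    push_cast
    have : (j : ℝ) * d * d = j := by
      rw [mul_assoc]; exact_mod_cast (by rw [hdd, mul_one] : j * (d * d) = j)
    rw [this]
  have hab : a = b + (j * d : ℤ) * (2 * π) := hinjH e
  rw [hab]
  exact (periodic_circlePoint.int_mul (j * d)) b

/-! ### The theorem -/

/-- **A local diffeomorphism of the circle which is pointwise close to a homeomorphism is a
diffeomorphism.** Let `ĥ : 𝕊¹ → 𝕊¹` be `C^∞` with injective differential at every point, and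
`Â` a homeomorphism of `𝕊¹` with `‖ĥ u - Â u‖ < 1` (chordal distance in `ℝ²`) for all `u`.  Then
`ĥ` is (the map of) a diffeomorphism of `𝕊¹`.  Proof: the lift `H` of `ĥ` is strictly monotone
(`deriv_lift_ne_zero_of_injective_mfderiv` and the intermediate value theorem for `H'`) and has
the degree of `Â`, namely `±1` (`degree_eq_of_close`, `degree_eq_one_or_of_homeomorph`), so `ĥ`
is injective (`injective_of_strictMono_lift`); it is surjective since its range is open (local
diffeomorphism), compact and the circle is connected; conclude with
`IsLocalDiffeomorph.diffeomorphOfBijective`.  This is the `k = 1` replacement of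
`TubeLink.exists_diffeomorph_sphere_linkMap` in the smoothing sweep (Munkres (1960), §4;
Campbell–D'Onofrio–Vítek (2026), Lemma 3.2). [cite: CampbellDonofrioVitek2026, Lemma 3.2] -/
theorem exists_diffeomorph_circle_of_close {ĥ : (𝕊 1) → 𝕊 1}
    (hsm : ContMDiff (𝓡 1) (𝓡 1) ∞ ĥ) (hinj : ∀ u, Injective (mfderiv (𝓡 1) (𝓡 1) ĥ u))
    (Â : (𝕊 1) ≃ₜ 𝕊 1) (hclose : ∀ u : 𝕊 1, ‖((ĥ u : 𝕊 1) : 𝔼 2) - Â u‖ < 1) :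
    ∃ φ : (𝕊 1) ≃ₘ⟮𝓡 1, 𝓡 1⟯ 𝕊 1, ∀ u, φ u = ĥ u := by
  have hloc : IsLocalDiffeomorph (𝓡 1) (𝓡 1) ∞ ĥ :=
    isLocalDiffeomorph_circle_of_injective_mfderiv hsm hinj
  -- lifts of `ĥ` and `Â` and their degrees
  obtain ⟨H, hH, hHl⟩ := exists_continuous_lift hsm.continuous
  obtain ⟨A, hA, hAl⟩ := exists_continuous_lift Â.continuous
  obtain ⟨d, hd⟩ := exists_int_apply_add_two_pi hH hHl
  obtain ⟨dA, hdA⟩ := exists_int_apply_add_two_pi hA hAl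
  have hdeg : d = dA := degree_eq_of_close hH hA hHl hAl hd hdA hclose
  have hd1 : d = 1 ∨ d = -1 := hdeg ▸ degree_eq_one_or_of_homeomorph Â hA hAl hdA
  -- `H` is strictly monotone
  have hne := deriv_lift_ne_zero_of_injective_mfderiv hsm hinj hH hHl
  have hHs : ContDiff ℝ ∞ H :=
    contDiff_of_circlePoint_comp_eq (hsm.comp contMDiff_circlePoint) hH hHl
  have hcont : Continuous (deriv H) := hHs.continuous_deriv (by simp)
  have hmono : StrictMono H ∨ StrictAnti H := by
    rcases (hne 0).lt_or_gt with hneg | hpos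
    · right
      refine strictAnti_of_deriv_neg fun x ↦ ?_
      by_contra hx
      obtain ⟨z, hz⟩ := intermediate_value_univ 0 x hcont ⟨hneg.le, not_lt.1 hx⟩
      exact hne z hz
    · left
      refine strictMono_of_deriv_pos fun x ↦ ?_
      by_contra hx
      obtain ⟨z, hz⟩ := intermediate_value_univ x 0 hcont ⟨not_lt.1 hx, hpos.le⟩
      exact hne z hz
  -- bijectivity
  have hinjective : Injective ĥ := injective_of_strictMono_lift hHl hmono hd hd1
  have hsurjective : Surjective ĥ := by
    have hopen : IsOpen (range ĥ) := hloc.isOpen_range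
    have hclosed : IsClosed (range ĥ) := (isCompact_range hsm.continuous).isClosed
    have hconn : ConnectedSpace (𝕊 1) := by
      refine isConnected_iff_connectedSpace.1 (isConnected_sphere ?_ 0 zero_le_one)
      rw [← Module.finrank_eq_rank, finrank_euclideanSpace_fin]
      norm_num
    have huniv : range ĥ = univ :=
      IsClopen.eq_univ ⟨hclosed, hopen⟩ (range_nonempty ĥ)
    exact range_eq_univ.1 huniv
  exact ⟨hloc.diffeomorphOfBijective ⟨hinjective, hsurjective⟩, fun u ↦ rfl⟩

end Literature.Topology.FourManifolds
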